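import Literature.RingTheory.KTheory.MilnorKRatFuncFiltration
import Literature.RingTheory.KTheory.KTwoRatFuncMilnorTate
import HarnessLib

/-!
# THEOREM 2.3: `0 → K_nF → K_nF(t) → ⊕_π K_{n−1}F[t]/(π) → 0` is split exact, in all degrees
# (Milnor, *Algebraic K-theory and quadratic forms*, Invent. Math. 9 (1970), §2)

Family `hodge`, lane `lit-hodgefound` (foundations library; seat `lit-hodgefound-p27`, generation 40, row g40-#3);
topic `RingTheory/KTheory`.  Sequel of `MilnorKTameSymbol` (g40-#1: LEMMA 2.1 `boundary`, LEMMA 2.2 `psi`), of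
`MilnorKRatFuncFiltration` (g40-#2: `filtrationK`, `constMap`, LEMMA 2.4 `hMapK`, LEMMA 2.5's generation half
`filtrationK_succ_eq`) and of the `K₂`-files `TameSymbolDedekind` / `RatFuncPrimeTameSymbols` / `KTwoRatFuncMilnorTate`
(g30/g39: `quotientEquivResidueFieldAt : F[t]/𝔭 ≃+* κ_𝔭`, `residueUnitsEquivQuotientUnits_residueUnitHom`,
`addVal_monicGen`, `addVal_polyUnit_…`, `finite_setOf_addVal_ne_zero`, `map_algebraMap_eq_polyUnit_C`).
DEFINITIONS WITH BODIES (`boundaryAt`, `hMapTotalK`, `primeT`, `evalZeroHom`, `psiRat`, `FinSuppFamily`,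
`boundaryFamily`) and PROVED THEOREMS; no named fact, no instance, no notation, 0 `sorry`, net debt 0 (D-0026).

## The source, verbatim

J. Milnor, *Algebraic K-theory and quadratic forms*, Invent. Math. 9 (1970) 318–344 (held `paper:doi-10-1007-bf01425486`;
bib key `Milnor1970`), §2 (p0008 L5–L27, p0009 L22–L30, p0010 L9–L16): «Now let F be an arbitrary field. We will use
2.1 and 2.2 to study the field F(t) of rational functions in one indeterminate over F. Each monic irreducible polynomial
π ∈ F[t] gives rise to a (π)-adic valuation on F(t) with residue class field F[t]/(π). Here (π) denotes the prime
ideal spanned by π. Hence there is an associated surjection ∂_π : K_nF(t) → K_{n−1}F[t]/(π).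
**THEOREM 2.3.** These homomorphisms ∂_π give rise to a split exact sequence
0 → K_nF → K_nF(t) → ⊕ K_{n−1}F[t]/(π) → 0, where the direct sum extends over all non-zero prime ideals (π).
This theorem is essentially due to Tate. In fact the proof below is an immediate generalization of Tate's proof for
the special case n = 2. *Proof.* Keeping n fixed, let L_d ⊂ K_nF(t) be the subgroup generated by those products
l(f₁)⋯l(fₙ) such that f₁, …, fₙ ∈ F[t] are polynomials of degree ≤ d. Thus L₀ ⊂ L₁ ⊂ L₂ ⊂ … with union K_nF(t).
Using the homomorphism ψ : K_*F(t) → K_*F of 2.2, where π is any monic (irreducible) polynomial of degree 1, we see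
easily that L₀ is a direct summand of K_nF(t), naturally isomorphic to K_nF. […] **LEMMA 2.5.** The homomorphisms
∂_π give rise to an isomorphism between L_d/L_{d−1} and the direct sum of K_{n−1}F[t]/(π) as π ranges over monic
irreducible polynomials of degree d. *Proof.* Inspection shows that each ∂_π induces a homomorphism
L_d/L_{d−1} → K_{n−1}F[t]/(π). Furthermore it is clear that the composition
K_{n−1}F[t]/(π) —h_π→ L_d/L_{d−1} —∂_{π′}→ K_{n−1}F[t]/(π′) is either the identity or zero, according as π = π′ or
π ≠ π′. So to complete the argument we need only to show that L_d/L_{d−1} is generated by the images of the h_π.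
[…] An easy induction on d now shows that the homomorphisms ∂_π induce an isomorphism from L_d/L₀ to the direct sum
of K_{n−1}F[t]/(π), taken over all monic irreducible π of degree ≤ d. Passing to the direct limit as d → ∞, this
completes the proof of Theorem 2.3.»

## What is formalised (for `K_{n+1}F(t) = MilnorK (RatFunc F) (n + 1)`, all `n ≥ 0`)

* §1 **`boundaryAt F n 𝔭 = ∂_𝔭 : K_{n+1}F(t) →+ K_n(F[t]/𝔭)`** (`boundary` of g40-#1 at `v_𝔭` with uniformizer `π_𝔭`,
  then `K_n` of `κ_𝔭 ≅ F[t]/𝔭`), its values `boundaryAt_symbol_eq_zero_of_units`, **`boundaryAt_symbol_cons_genUnit`**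
  (`∂_𝔭{π_𝔭, g} = {ḡ}`), `boundaryAt_symbol_cons_genUnit_of_ne` (`∂_{𝔭′}{π_𝔭, g} = 0`),
  `boundaryAt_eq_zero_of_mem_filtrationK` (`∂_𝔭(L_d) = 0`, `deg 𝔭 > d`), `boundaryAt_constMap` (the complex), and
  **`finite_setOf_boundaryAt_ne_zero`** (the family `(∂_𝔭 z)_𝔭` is finitely supported).
* §2 LEMMA 2.5's injectivity half and exactness at `K_{n+1}F(t)`: `hMapTotalK`, **`mk_eq_finsum_of_mem_topPartK`**
  (`[h] = Σ_𝔭 h_𝔭(∂_𝔭 h)` for `h ∈ topPartK d`), **`mem_filtrationK_of_mem_succ`**, «an easy induction on d»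
  `mem_filtrationK_zero_of_boundaryAt_eq_zero`, and **`forall_boundaryAt_eq_zero_iff`** (`∀ 𝔭, ∂_𝔭 z = 0 ↔ z ∈ K_{n+1}F`).
* §3 exactness at `⊕`: the lifts `exists_boundaryAt_eq_and_eq_zero`, the triangular induction
  `exists_forall_boundaryAt_eq_of_support`, **`exists_forall_boundaryAt_eq`** (every finitely supported `(e_𝔭)` is a
  `(∂_𝔭 u)_𝔭`), `boundaryAt_surjective` («an associated surjection ∂_π»).
* §4 the splitting and the theorem: `primeT = (t)`, `evalZeroHom : F[t]/(t) → F`, **`psiRat F n = ψ : K_nF(t) →+ K_nF`**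
  (Lemma 2.2 at `(t)`), **`psiRat_constMap`** (`ψ ∘ ι = id`), **`constMap_injective`**, the direct sum as the type
  `FinSuppFamily F n` of finitely supported families, `boundaryFamily`, and **THEOREM 2.3
  `bijective_psiRat_prod_boundaryFamily`**: `z ↦ (ψ z, (∂_𝔭 z)_𝔭)` is a bijection
  `K_{n+1}F(t) → K_{n+1}F × ⊕_𝔭 K_n(F[t]/𝔭)`.

Design note.  The direct sum is presented as the TYPE of finitely supported families and the exactness clauses are
stated index-free, because Lean's instance synthesis does not assemble the pointwise `AddCommGroup` structure on the
dependent family `𝔭 ↦ MilnorK (F[t] ⧸ 𝔭) n` under the binder (the units of a dependent family of rings inside the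
tensor-power binder), and Literature files declare no instances.  Nothing of the theorem is lost: injectivity of
`K_{n+1}F → K_{n+1}F(t)` with its retraction `ψ`, `⋂ ker ∂_𝔭 = K_{n+1}F`, finiteness of supports and joint
surjectivity of the `∂_𝔭` onto the finitely supported families are exactly «split exact».

## References

* [Milnor1970] J. Milnor, *Algebraic K-theory and quadratic forms*, Invent. Math. 9 (1970) 318–344 — §2 Theorem 2.3
  (p0008 L12–L16), its proof (p0008 L17–L27, p0010 L9–L16), Lemma 2.5 (p0009 L22–L30, p0010 L6–L12); Lemmas 2.1/2.2
  (p0005 L36 – p0007 L51).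

Provenance: lane `lit-hodgefound`, seat `lit-hodgefound-p27` gen 40 (agent `literature-prover-lit-hodgefound-p27-g40-0`),
row g40-#3.
-/

set_option autoImplicit false

noncomputable section

namespace Literature.RingTheory.KTheory

namespace MilnorK

open Function Polynomial IsDedekindDomain

variable (F : Type*) [Field F] (n : ℕ)

/-! ### §1 `∂_𝔭 : K_{n+1}F(t) → K_n(F[t]/𝔭)` -/

section BoundaryAt

/-- **`∂_𝔭 : K_{n+1}F(t) → K_n(F[t]/𝔭)`** — Lemma 2.1's `∂_v` for the `𝔭`-adic valuation of `F(t)` (uniformizer the monic generator `π_𝔭`), followed by the identification of the residue field of the valuation ring with `F[t]/𝔭` («Each monic irreducible polynomial π ∈ F[t] gives rise to a (π)-adic valuation on F(t) with residue class field F[t]/(π) … Hence there is an associated surjection ∂_π : K_nF(t) → K_{n−1}F[t]/(π)»). [cite: Milnor1970, §2 before Theorem 2.3 (p0008 L7–L11)] -/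
def boundaryAt (v : HeightOneSpectrum F[X]) : MilnorK (RatFunc F) (n + 1) →+ MilnorK (F[X] ⧸ v.asIdeal) n :=
  (MilnorK.map (quotientEquivResidueFieldAt F[X] (RatFunc F) v).symm.toRingHom).comp
    (boundary (v.valuation (RatFunc F)) (addVal_monicGen F v) n)

variable {F n}

/-- Unfolding `∂_𝔭`. [cite: Milnor1970, §2 before Theorem 2.3 (p0008 L7–L11)] -/
theorem boundaryAt_apply (v : HeightOneSpectrum F[X]) (z : MilnorK (RatFunc F) (n + 1)) :
    boundaryAt F n v z = MilnorK.map (quotientEquivResidueFieldAt F[X] (RatFunc F) v).symm.toRingHom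
      (boundary (v.valuation (RatFunc F)) (addVal_monicGen F v) n z) := rfl

/-- `∂_𝔭{a} = 0` when all entries are `𝔭`-units (Lemma 2.1: «∂ annihilates every product of the form l(u₁)⋯l(uₙ)»). [cite: Milnor1970, §2 Lemma 2.1 (p0005 L38–L39)] -/
theorem boundaryAt_symbol_eq_zero_of_units (v : HeightOneSpectrum F[X]) (a : Fin (n + 1) → (RatFunc F)ˣ)
    (ha : ∀ j, addVal (v.valuation (RatFunc F)) (a j) = 0) : boundaryAt F n v (symbol a) = 0 := by
  rw [boundaryAt_apply, boundary_symbol_eq_zero_of_units _ _ n a ha, map_zero]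

/-- Under `κ_𝔭 ≅ F[t]/𝔭` the residue of the `𝔭`-unit `g ∈ F[t] ∖ 𝔭` is the class `ḡ`. [cite: Milnor1970, §2 «with residue class field F[t]/(π)» (p0008 L7–L9)] -/
theorem units_map_residueUnitHom_polyUnit (v : HeightOneSpectrum F[X]) {g : F[X]} (hg : g ≠ 0) (hgv : g ∉ v.asIdeal) :
    Units.map ((quotientEquivResidueFieldAt F[X] (RatFunc F) v).symm.toRingHom : ResidueFieldAt F[X] (RatFunc F) v →* F[X] ⧸ v.asIdeal)
        (residueUnitHom (v.valuation (RatFunc F)) (unitOfEqOne (v.valuation (RatFunc F)) (polyUnit F g hg)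
          (addVal_polyUnit_eq_zero_of_not_mem F v hg hgv))) =
      residueClassUnit F v g hgv := by
  have h := residueUnitsEquivQuotientUnits_residueUnitHom F[X] (RatFunc F) v hgv (polyUnit F g hg).ne_zero
  refine Units.ext ?_
  rw [Units.coe_map, MonoidHom.coe_coe, RingEquiv.toRingHom_eq_coe, RingHom.coe_coe, ← coe_residueUnitsEquivQuotientUnits]
  exact congrArg Units.val h

/-- **`∂_𝔭{π_𝔭, g₁, …, gₙ} = {ḡ₁, …, ḡₙ}`** for polynomials `gⱼ ∉ 𝔭` (Lemma 2.1's defining property at `v_𝔭`; «the composition ∂_π ∘ h_π is the identity»). [cite: Milnor1970, §2 Lemma 2.1 (p0005 L36–L38), proof of Lemma 2.5 (p0009 L27–L30)] -/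
theorem boundaryAt_symbol_cons_genUnit (v : HeightOneSpectrum F[X]) (g : Fin n → F[X]) (hg : ∀ j, g j ≠ 0)
    (hgv : ∀ j, g j ∉ v.asIdeal) :
    boundaryAt F n v (symbol (Fin.cons (genUnit F v) (fun j => polyUnit F (g j) (hg j)) : Fin (n + 1) → (RatFunc F)ˣ)) =
      symbol (fun j => residueClassUnit F v (g j) (hgv j)) := by
  rw [boundaryAt_apply, boundary_symbol_cons_units _ _ n (addVal_monicGen F v) _
    (fun j => addVal_polyUnit_eq_zero_of_not_mem F v (hg j) (hgv j)), MilnorK.map_symbol]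
  congr 1; funext j
  exact units_map_residueUnitHom_polyUnit v (hg j) (hgv j)

/-- **`∂_{𝔭′}{π_𝔭, g₁, …, gₙ} = 0`** for `𝔭′ ≠ 𝔭` and `gⱼ ∉ 𝔭′` («or zero, according as π = π′ or π ≠ π′»). [cite: Milnor1970, §2 proof of Lemma 2.5 (p0009 L27–L30)] -/
theorem boundaryAt_symbol_cons_genUnit_of_ne {v w : HeightOneSpectrum F[X]} (hvw : v ≠ w) (g : Fin n → F[X])
    (hg : ∀ j, g j ≠ 0) (hgw : ∀ j, g j ∉ w.asIdeal) :
    boundaryAt F n w (symbol (Fin.cons (genUnit F v) (fun j => polyUnit F (g j) (hg j)) : Fin (n + 1) → (RatFunc F)ˣ)) = 0 :=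
  boundaryAt_symbol_eq_zero_of_units w _ fun j => Fin.cases
    (by rw [Fin.cons_zero]; exact addVal_polyUnit_eq_zero_of_not_mem F w _ (monicGen_not_mem_of_ne F hvw))
    (fun k => by rw [Fin.cons_succ]; exact addVal_polyUnit_eq_zero_of_not_mem F w (hg k) (hgw k)) j

/-- **`∂_𝔭(L_d) = 0` for `deg 𝔭 > d`** (all polynomials of degree `≤ d` are `𝔭`-units; «Inspection shows that each ∂_π induces a homomorphism L_d/L_{d−1} → K_{n−1}F[t]/(π)»). [cite: Milnor1970, §2 proof of Lemma 2.5 (p0009 L26–L27)] -/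
theorem boundaryAt_eq_zero_of_mem_filtrationK {d : ℕ} {z : MilnorK (RatFunc F) (n + 1)} (hz : z ∈ filtrationK F (n + 1) d)
    (w : HeightOneSpectrum F[X]) (hw : d < primeDeg F w) : boundaryAt F n w z = 0 := by
  have hle : filtrationK F (n + 1) d ≤ (boundaryAt F n w).ker := by
    rw [filtrationK, AddSubgroup.closure_le]
    rintro z ⟨a, ha, rfl⟩
    rw [SetLike.mem_coe, AddMonoidHom.mem_ker]
    refine boundaryAt_symbol_eq_zero_of_units w a fun j => ?_
    obtain ⟨f, hf, hdf, hfa⟩ := ha j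
    rw [← hfa]
    exact addVal_polyUnit_eq_zero_of_natDegree_lt F w hf (lt_of_le_of_lt hdf hw)
  exact (AddMonoidHom.mem_ker).1 (hle hz)

/-- **`∂_𝔭 ∘ (K_{n+1}F → K_{n+1}F(t)) = 0`**: constants are units everywhere (the sequence of Theorem 2.3 is a complex). [cite: Milnor1970, §2 Theorem 2.3 (p0008 L12–L16)] -/
theorem boundaryAt_constMap (v : HeightOneSpectrum F[X]) (x : MilnorK F (n + 1)) : boundaryAt F n v (constMap F (n + 1) x) = 0 := by
  have h : (boundaryAt F n v).comp (constMap F (n + 1)) = 0 := hom_ext fun c => by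
    rw [AddMonoidHom.comp_apply, AddMonoidHom.zero_apply, constMap_symbol]
    refine boundaryAt_symbol_eq_zero_of_units v _ fun j => ?_
    rw [map_algebraMap_eq_polyUnit_C]
    exact addVal_polyUnit_C F v (c j).ne_zero
  exact DFunLike.congr_fun h x

/-- **`∂_𝔭 z = 0` for all but finitely many `𝔭`** — `(∂_𝔭 z)_𝔭` lies in the DIRECT sum («where the direct sum extends over all non-zero prime ideals (π)»). [cite: Milnor1970, §2 Theorem 2.3 (p0008 L12–L16)] -/
theorem finite_setOf_boundaryAt_ne_zero (z : MilnorK (RatFunc F) (n + 1)) :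
    {v : HeightOneSpectrum F[X] | boundaryAt F n v z ≠ 0}.Finite := by
  induction z using induction_on with
  | hsym k a =>
    refine Set.Finite.subset (Set.Finite.biUnion (Set.finite_univ : (Set.univ : Set (Fin (n + 1))).Finite)
      fun j _ => finite_setOf_addVal_ne_zero F[X] (RatFunc F) (a j)) fun v hv => ?_
    rw [Set.mem_setOf_eq, map_zsmul] at hv
    rw [Set.mem_iUnion₂]
    by_contra hall
    simp only [Set.mem_univ, Set.mem_setOf_eq, exists_const, not_exists, not_not] at hall
    exact hv (by rw [boundaryAt_symbol_eq_zero_of_units v a hall, zsmul_zero])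
  | hadd x y hx hy =>
    refine Set.Finite.subset (hx.union hy) fun v hv => ?_
    rw [Set.mem_setOf_eq, map_add] at hv
    by_contra h
    simp only [Set.mem_union, Set.mem_setOf_eq, not_or, not_not] at h
    exact hv (by rw [h.1, h.2, add_zero])

end BoundaryAt

/-! ### §2 LEMMA 2.5, injectivity half, and exactness at `K_{n+1}F(t)` -/

section Exact

variable {F n}

/-- `h_𝔭` for every prime: Lemma 2.4's `hMapK` when `deg 𝔭 = d + 1`, zero otherwise (so that sums over all primes make sense). [cite: Milnor1970, §2 Lemma 2.4 (p0008 L28–L31)] -/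
def hMapTotalK (d : ℕ) (w : HeightOneSpectrum F[X]) :
    MilnorK (F[X] ⧸ w.asIdeal) n →+ MilnorK (RatFunc F) (n + 1) ⧸ filtrationK F (n + 1) d :=
  if hv : primeDeg F w = d + 1 then hMapK n d w hv else 0

/-- `hMapTotalK = hMapK` in degree `d + 1`. [cite: Milnor1970, §2 Lemma 2.4 (p0008 L28–L31)] -/
theorem hMapTotalK_of_eq {d : ℕ} {w : HeightOneSpectrum F[X]} (hv : primeDeg F w = d + 1) :
    hMapTotalK (F := F) (n := n) d w = hMapK n d w hv := dif_pos hv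

/-- `hMapTotalK = 0` off degree `d + 1`. [cite: Milnor1970, §2 Lemma 2.4 (p0008 L28–L31)] -/
theorem hMapTotalK_of_ne {d : ℕ} {w : HeightOneSpectrum F[X]} (hv : primeDeg F w ≠ d + 1) :
    hMapTotalK (F := F) (n := n) d w = 0 := dif_neg hv

/-- The sums below are finite. [cite: Milnor1970, §2 Lemma 2.5 and its proof (p0009 L22–L30, p0010 L6–L12)] -/
theorem finite_support_hMapTotalK (d : ℕ) (z : MilnorK (RatFunc F) (n + 1)) :
    (Function.support fun w => hMapTotalK d w (boundaryAt F n w z)).Finite := by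
  refine (finite_setOf_boundaryAt_ne_zero z).subset fun w hw => ?_
  rw [Function.mem_support] at hw
  rw [Set.mem_setOf_eq]
  intro h0
  exact hw (by rw [h0, map_zero])

/-- **«the composition ∂_{π′} ∘ h_π is either the identity or zero, according as π = π′ or π ≠ π′», turned around**: every `h ∈ topPartK d` is, modulo `L_d`, the sum over the primes `𝔭` of degree `d + 1` of `h_𝔭(∂_𝔭 h)`. [cite: Milnor1970, §2 Lemma 2.5 and its proof (p0009 L22–L30, p0010 L6–L12)] -/
theorem mk_eq_finsum_of_mem_topPartK {d : ℕ} {h : MilnorK (RatFunc F) (n + 1)} (hh : h ∈ topPartK F n d) :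
    (QuotientAddGroup.mk h : MilnorK (RatFunc F) (n + 1) ⧸ filtrationK F (n + 1) d) =
      ∑ᶠ w, hMapTotalK d w (boundaryAt F n w h) := by
  induction hh using AddSubgroup.closure_induction with
  | mem x hx =>
    obtain ⟨v, g, hv, hg, rfl⟩ := hx
    choose f hf hdf hfg using hg
    have hgf : g = fun j => polyUnit F (f j) (hf j) := funext fun j => (hfg j).symm
    have hfv : ∀ j, f j ∉ v.asIdeal := fun j => not_mem_of_natDegree_lt F v (hf j) (by rw [hv]; exact Nat.lt_succ_of_le (hdf j))
    rw [finsum_eq_single _ v]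
    · rw [hMapTotalK_of_eq hv, hgf, boundaryAt_symbol_cons_genUnit v f hf hfv]
      exact (hMapK_symbol_residueClassUnit v hv f hf hdf).symm
    · intro w hwv
      by_cases hw : primeDeg F w = d + 1
      · rw [hgf, boundaryAt_symbol_cons_genUnit_of_ne (Ne.symm hwv) f hf
          (fun j => not_mem_of_natDegree_lt F w (hf j) (by rw [hw]; exact Nat.lt_succ_of_le (hdf j))), map_zero]
      · rw [hMapTotalK_of_ne hw, AddMonoidHom.zero_apply]
  | zero =>
    rw [QuotientAddGroup.mk_zero, eq_comm]
    exact finsum_eq_zero_of_forall_eq_zero fun w => by rw [map_zero, map_zero]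
  | add x y _ _ ihx ihy =>
    rw [QuotientAddGroup.mk_add, ihx, ihy, ← finsum_add_distrib (finite_support_hMapTotalK d _) (finite_support_hMapTotalK d _)]
    exact finsum_congr fun w => by rw [map_add, map_add]
  | neg x _ ihx =>
    rw [QuotientAddGroup.mk_neg, ihx, ← finsum_neg_distrib]
    exact finsum_congr fun w => by rw [map_neg, map_neg]

/-- **LEMMA 2.5, injectivity on the graded piece**: an element of `L_{d+1}` all of whose `∂_𝔭`, `deg 𝔭 = d + 1`, vanish lies in `L_d` («The homomorphisms ∂_π give rise to an isomorphism between L_d/L_{d−1} and the direct sum of K_{n−1}F[t]/(π) as π ranges over monic irreducible polynomials of degree d»). [cite: Milnor1970, §2 Lemma 2.5 and its proof (p0009 L22–L30, p0010 L6–L12)] -/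
theorem mem_filtrationK_of_mem_succ {d : ℕ} {u : MilnorK (RatFunc F) (n + 1)} (hu : u ∈ filtrationK F (n + 1) (d + 1))
    (h0 : ∀ w : HeightOneSpectrum F[X], primeDeg F w = d + 1 → boundaryAt F n w u = 0) :
    u ∈ filtrationK F (n + 1) d := by
  rw [filtrationK_succ_eq, AddSubgroup.mem_sup] at hu
  obtain ⟨b, hb, h, hh, rfl⟩ := hu
  have hh0 : ∀ w : HeightOneSpectrum F[X], primeDeg F w = d + 1 → boundaryAt F n w h = 0 := by
    intro w hw
    have h1 := h0 w hw
    rwa [map_add, boundaryAt_eq_zero_of_mem_filtrationK hb w (by rw [hw]; exact Nat.lt_succ_self d), zero_add] at h1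
  have hkey := mk_eq_finsum_of_mem_topPartK hh
  rw [finsum_eq_zero_of_forall_eq_zero, QuotientAddGroup.eq_zero_iff] at hkey
  · exact AddSubgroup.add_mem _ hb hkey
  · intro w
    by_cases hw : primeDeg F w = d + 1
    · rw [hh0 w hw, map_zero]
    · rw [hMapTotalK_of_ne hw, AddMonoidHom.zero_apply]

/-- **«An easy induction on d»**: an element of `L_d` with all `∂_𝔭` zero lies in `L₀`. [cite: Milnor1970, §2 proof of Theorem 2.3 (p0008 L17–L24, p0010 L9–L12)] -/
theorem mem_filtrationK_zero_of_boundaryAt_eq_zero {d : ℕ} {u : MilnorK (RatFunc F) (n + 1)}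
    (hu : u ∈ filtrationK F (n + 1) d) (h0 : ∀ w : HeightOneSpectrum F[X], boundaryAt F n w u = 0) :
    u ∈ filtrationK F (n + 1) 0 := by
  induction d with
  | zero => exact hu
  | succ d ih => exact ih (mem_filtrationK_of_mem_succ hu fun w _ => h0 w)

/-- **THEOREM 2.3, EXACTNESS AT `K_{n+1}F(t)`: `∂_𝔭 z = 0` for all `𝔭` iff `z` comes from `K_{n+1}F`.** [cite: Milnor1970, §2 Theorem 2.3 (p0008 L12–L16)] -/
theorem forall_boundaryAt_eq_zero_iff (z : MilnorK (RatFunc F) (n + 1)) :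
    (∀ v : HeightOneSpectrum F[X], boundaryAt F n v z = 0) ↔ z ∈ (constMap F (n + 1)).range := by
  refine ⟨fun h0 => ?_, ?_⟩
  · obtain ⟨d, hd⟩ := exists_mem_filtrationK z
    exact filtrationK_zero_le_range_constMap (mem_filtrationK_zero_of_boundaryAt_eq_zero hd h0)
  · rintro ⟨b, rfl⟩ v
    exact boundaryAt_constMap v b

end Exact

/-! ### §3 surjectivity onto the finitely supported families -/

section Surjective

variable {F n}

/-- Lifts for the triangular induction: for `x ∈ K_n(F[t]/𝔭)` an element `y` with `∂_𝔭 y = x` and `∂_{𝔭′} y = 0` for every `𝔭′ ≠ 𝔭` of degree `≥ deg 𝔭` (representatives of degree `< deg 𝔭`). [cite: Milnor1970, §2 proof of Theorem 2.3 «the homomorphisms ∂_π induce an isomorphism from L_d/L₀ to the direct sum … of degree ≤ d» (p0010 L9–L12)] -/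
theorem exists_boundaryAt_eq_and_eq_zero (w : HeightOneSpectrum F[X]) (x : MilnorK (F[X] ⧸ w.asIdeal) n) :
    ∃ y : MilnorK (RatFunc F) (n + 1), boundaryAt F n w y = x ∧
      ∀ w' : HeightOneSpectrum F[X], w' ≠ w → primeDeg F w ≤ primeDeg F w' → boundaryAt F n w' y = 0 := by
  induction x using induction_on with
  | hsym k u =>
    have hrep : ∀ j, hRep F w (u j) ∉ w.asIdeal :=
      fun j => not_mem_of_natDegree_lt F w (hRep_ne_zero F w (u j)) (natDegree_hRep_lt F w (u j))
    refine ⟨k • symbol (Fin.cons (genUnit F w) (fun j => polyUnit F (hRep F w (u j)) (hRep_ne_zero F w (u j))) :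
      Fin (n + 1) → (RatFunc F)ˣ), ?_, fun w' hne hle => ?_⟩
    · rw [map_zsmul, boundaryAt_symbol_cons_genUnit w _ _ hrep]
      congr 2; funext j; exact residueClassUnit_hRep F w (u j)
    · rw [map_zsmul, boundaryAt_symbol_cons_genUnit_of_ne (Ne.symm hne) _ _ (fun j =>
        not_mem_of_natDegree_lt F w' (hRep_ne_zero F w (u j)) (lt_of_lt_of_le (natDegree_hRep_lt F w (u j)) hle)),
        zsmul_zero]
  | hadd x y hx hy =>
    obtain ⟨a, ha, ha'⟩ := hx
    obtain ⟨b, hb, hb'⟩ := hy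
    exact ⟨a + b, by rw [map_add, ha, hb], fun w' h1 h2 => by rw [map_add, ha' w' h1 h2, hb' w' h1 h2, add_zero]⟩

/-- **Surjectivity by induction on the degree of the support**: every finitely supported family supported in degrees `≤ N` is `(∂_𝔭 u)_𝔭`. [cite: Milnor1970, §2 proof of Theorem 2.3 (p0008 L17–L24, p0010 L9–L12)] -/
theorem exists_forall_boundaryAt_eq_of_support (N : ℕ) :
    ∀ e : (v : HeightOneSpectrum F[X]) → MilnorK (F[X] ⧸ v.asIdeal) n, {v | e v ≠ 0}.Finite →
      (∀ w : HeightOneSpectrum F[X], N < primeDeg F w → e w = 0) →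
      ∃ u : MilnorK (RatFunc F) (n + 1), ∀ v, boundaryAt F n v u = e v := by
  classical
  induction N with
  | zero =>
    intro e _ he
    exact ⟨0, fun v => by rw [map_zero, he v (primeDeg_pos F v)]⟩
  | succ N ih =>
    intro e hfin he
    choose y hy hy' using fun w : HeightOneSpectrum F[X] => exists_boundaryAt_eq_and_eq_zero w (e w)
    set T : Finset (HeightOneSpectrum F[X]) := hfin.toFinset.filter fun w => primeDeg F w = N + 1 with hT
    set a : MilnorK (RatFunc F) (n + 1) := ∑ w ∈ T, y w with ha
    -- `∂_{w₀} a = e w₀` in degrees `> N`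
    have hcomp : ∀ w₀ : HeightOneSpectrum F[X], N < primeDeg F w₀ → boundaryAt F n w₀ a = e w₀ := by
      intro w₀ hw₀
      rw [ha, map_sum]
      rcases Nat.lt_or_ge (N + 1) (primeDeg F w₀) with hgt | hle
      · rw [he w₀ hgt]
        refine Finset.sum_eq_zero fun w hw => ?_
        have hw' : primeDeg F w = N + 1 := (Finset.mem_filter.1 hw).2
        exact hy' w w₀ (fun h => by rw [h, hw'] at hgt; exact lt_irrefl _ hgt) (by rw [hw']; exact hgt.le)
      · have hw₀ : primeDeg F w₀ = N + 1 := le_antisymm hle hw₀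
        rw [Finset.sum_eq_single w₀]
        · exact hy w₀
        · intro w hw hww₀
          have hw' : primeDeg F w = N + 1 := (Finset.mem_filter.1 hw).2
          exact hy' w w₀ (Ne.symm hww₀) (by rw [hw', hw₀])
        · intro hw₀T
          have he0 : e w₀ = 0 := by
            by_contra hne
            exact hw₀T (Finset.mem_filter.2 ⟨hfin.mem_toFinset.2 hne, hw₀⟩)
          rw [hy w₀, he0]
    -- correct and descend
    obtain ⟨u, hu⟩ := ih (fun v => e v - boundaryAt F n v a)
      ((hfin.union (finite_setOf_boundaryAt_ne_zero a)).subset fun v hv => by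
        by_contra h
        simp only [Set.mem_union, Set.mem_setOf_eq, not_or, not_not] at h
        exact hv (by simp only [h.1, h.2, sub_zero]))
      (fun w hw => by simp only [hcomp w hw, sub_self])
    exact ⟨u + a, fun v => by rw [map_add, hu, sub_add_cancel]⟩

/-- **THEOREM 2.3, EXACTNESS AT `⊕`: every finitely supported family `(e_𝔭) ∈ ⊕_𝔭 K_n(F[t]/𝔭)` is `(∂_𝔭 u)_𝔭` for some `u ∈ K_{n+1}F(t)`.** [cite: Milnor1970, §2 Theorem 2.3 (p0008 L12–L16)] -/
theorem exists_forall_boundaryAt_eq (e : (v : HeightOneSpectrum F[X]) → MilnorK (F[X] ⧸ v.asIdeal) n)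
    (he : {v | e v ≠ 0}.Finite) : ∃ u : MilnorK (RatFunc F) (n + 1), ∀ v, boundaryAt F n v u = e v := by
  classical
  refine exists_forall_boundaryAt_eq_of_support (he.toFinset.sup (primeDeg F)) e he fun w hw => ?_
  by_contra hne
  exact absurd (Finset.le_sup (f := primeDeg F) (he.mem_toFinset.2 hne)) (not_le.2 hw)

/-- Each `∂_𝔭` is onto («Hence there is an associated surjection ∂_π»). [cite: Milnor1970, §2 before Theorem 2.3 (p0008 L9–L11)] -/
theorem boundaryAt_surjective (v : HeightOneSpectrum F[X]) : Function.Surjective (boundaryAt F n v) := by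
  intro x
  set e := quotientEquivResidueFieldAt F[X] (RatFunc F) v with he
  obtain ⟨z, hz⟩ := boundary_surjective (v.valuation (RatFunc F)) (addVal_monicGen F v) (n := n) (MilnorK.map e.toRingHom x)
  refine ⟨z, ?_⟩
  rw [boundaryAt_apply, hz, ← AddMonoidHom.comp_apply, MilnorK.map_comp, RingEquiv.toRingHom_eq_coe,
    RingEquiv.toRingHom_eq_coe, RingEquiv.symm_comp, MilnorK.map_id, AddMonoidHom.id_apply]

end Surjective

/-! ### §4 the splitting by `ψ` at `(t)` and THEOREM 2.3 -/

section Split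

/-- The prime `(t)` of degree one («where π is any monic (irreducible) polynomial of degree 1»). [cite: Milnor1970, §2 proof of Theorem 2.3 (p0008 L20–L23)] -/
def primeT : HeightOneSpectrum F[X] := primeOf F X irreducible_X

/-- Its monic generator is `t`. [cite: Milnor1970, §2 proof of Theorem 2.3 (p0008 L20–L23)] -/
theorem monicGen_primeT : monicGen F (primeT F) = X := monicGen_primeOf F X monic_X irreducible_X

/-- Membership in `(t)`. [cite: Milnor1970, §2 proof of Theorem 2.3 (p0008 L20–L23)] -/
theorem mem_primeT_iff (g : F[X]) : g ∈ (primeT F).asIdeal ↔ X ∣ g := Ideal.mem_span_singleton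

/-- `F[t]/(t) → F`, `g ↦ g(0)` (the residue field of the degree-one prime is `F`). [cite: Milnor1970, §2 proof of Theorem 2.3 «ψ : K_*F(t) → K_*F» (p0008 L20–L23)] -/
def evalZeroHom : F[X] ⧸ (primeT F).asIdeal →+* F :=
  Ideal.Quotient.lift (primeT F).asIdeal (evalRingHom 0) fun g hg => by
    obtain ⟨h, rfl⟩ := (mem_primeT_iff F g).1 hg
    rw [coe_evalRingHom, eval_mul, eval_X, zero_mul]

/-- `evalZeroHom ḡ = g(0)`. [cite: Milnor1970, §2 proof of Theorem 2.3 (p0008 L20–L23)] -/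
theorem evalZeroHom_mk (g : F[X]) : evalZeroHom F (Ideal.Quotient.mk (primeT F).asIdeal g) = eval 0 g :=
  Ideal.Quotient.lift_mk _ _ _

/-- **`ψ : K_nF(t) → K_nF`**: Lemma 2.2's `ψ_π` for `π = t`, through `κ_{(t)} ≅ F[t]/(t) ≅ F` («Using the homomorphism ψ : K_*F(t) → K_*F of 2.2, where π is any monic (irreducible) polynomial of degree 1, we see easily that L₀ is a direct summand of K_nF(t), naturally isomorphic to K_nF»). [cite: Milnor1970, §2 proof of Theorem 2.3 (p0008 L20–L23)] -/
def psiRat : MilnorK (RatFunc F) n →+ MilnorK F n :=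
  (MilnorK.map (evalZeroHom F)).comp
    ((MilnorK.map (quotientEquivResidueFieldAt F[X] (RatFunc F) (primeT F)).symm.toRingHom).comp
      (psi ((primeT F).valuation (RatFunc F)) (addVal_monicGen F (primeT F)) n))

variable {F n}

/-- Unfolding `psiRat`. [cite: Milnor1970, §2 proof of Theorem 2.3 (p0008 L20–L23)] -/
theorem psiRat_apply (z : MilnorK (RatFunc F) n) : psiRat F n z = MilnorK.map (evalZeroHom F)
    (MilnorK.map (quotientEquivResidueFieldAt F[X] (RatFunc F) (primeT F)).symm.toRingHom
      (psi ((primeT F).valuation (RatFunc F)) (addVal_monicGen F (primeT F)) n z)) := rfl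

/-- **THE SPLITTING `ψ ∘ (K_nF → K_nF(t)) = id`** (a constant `a` is a `(t)`-unit with residue `a`). [cite: Milnor1970, §2 Theorem 2.3 «split exact» (p0008 L12–L13), proof (p0008 L20–L23)] -/
theorem psiRat_constMap (x : MilnorK F n) : psiRat F n (constMap F n x) = x := by
  have h : (psiRat F n).comp (constMap F n) = AddMonoidHom.id _ := hom_ext fun c => by
    rw [AddMonoidHom.comp_apply, AddMonoidHom.id_apply, constMap_symbol, psiRat_apply, psi_symbol, MilnorK.map_symbol,
      MilnorK.map_symbol]
    congr 1; funext j
    have hC : (C (c j : F)) ≠ 0 := by rw [Ne, C_eq_zero]; exact (c j).ne_zero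
    have hCv : C (c j : F) ∉ (primeT F).asIdeal := C_not_mem F (primeT F) (c j).ne_zero
    rw [map_algebraMap_eq_polyUnit_C, res_of_addVal_eq_zero _ _ (addVal_polyUnit_eq_zero_of_not_mem F (primeT F) hC hCv),
      units_map_residueUnitHom_polyUnit (primeT F) hC hCv]
    refine Units.ext ?_
    rw [Units.coe_map, MonoidHom.coe_coe, coe_residueClassUnit, evalZeroHom_mk, eval_C]
  exact DFunLike.congr_fun h x

/-- The splitting as an identity of homomorphisms. [cite: Milnor1970, §2 proof of Theorem 2.3 (p0008 L20–L23)] -/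
theorem psiRat_comp_constMap : (psiRat F n).comp (constMap F n) = AddMonoidHom.id _ := AddMonoidHom.ext psiRat_constMap

/-- **THEOREM 2.3, EXACTNESS AT `K_nF`: `K_nF → K_nF(t)` is injective.** [cite: Milnor1970, §2 Theorem 2.3 (p0008 L12–L16)] -/
theorem constMap_injective : Function.Injective (constMap F n) :=
  Function.LeftInverse.injective psiRat_constMap

variable (F n)

/-- **The direct sum `⊕_𝔭 K_n(F[t]/𝔭)`** as the type of finitely supported families `(e_𝔭)`, `e_𝔭 ∈ K_n(F[t]/𝔭)` («where the direct sum extends over all non-zero prime ideals (π)»).  A bare type: Lean's instance synthesis does not assemble the pointwise group structure on `𝔭 ↦ K_n(F[t]/𝔭)` under the binder, and this file declares no instances; the group-theoretic content is carried by the index-free statements `forall_boundaryAt_eq_zero_iff`, `exists_forall_boundaryAt_eq`, `finite_setOf_boundaryAt_ne_zero`. [cite: Milnor1970, §2 Theorem 2.3 (p0008 L12–L16)] -/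
def FinSuppFamily : Type _ :=
  {e : (v : HeightOneSpectrum F[X]) → MilnorK (F[X] ⧸ v.asIdeal) n // {v | e v ≠ 0}.Finite}

variable {F n}

/-- `z ↦ (∂_𝔭 z)_𝔭 ∈ ⊕_𝔭 K_n(F[t]/𝔭)` («These homomorphisms ∂_π give rise to …»). [cite: Milnor1970, §2 Theorem 2.3 (p0008 L12–L16)] -/
def boundaryFamily (z : MilnorK (RatFunc F) (n + 1)) : FinSuppFamily F n :=
  ⟨fun v => boundaryAt F n v z, finite_setOf_boundaryAt_ne_zero z⟩

/-- The `𝔭`-component of `boundaryFamily z` is `∂_𝔭 z`. [cite: Milnor1970, §2 Theorem 2.3 (p0008 L12–L16)] -/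
theorem boundaryFamily_apply (z : MilnorK (RatFunc F) (n + 1)) (v : HeightOneSpectrum F[X]) :
    (boundaryFamily z).1 v = boundaryAt F n v z := rfl

/-- **THEOREM 2.3.** «These homomorphisms ∂_π give rise to a split exact sequence 0 → K_nF → K_nF(t) → ⊕ K_{n−1}F[t]/(π) → 0, where the direct sum extends over all non-zero prime ideals (π).» Packaged form: `z ↦ (ψ z, (∂_𝔭 z)_𝔭)` is a bijection `K_{n+1}F(t) → K_{n+1}F × ⊕_𝔭 K_n(F[t]/𝔭)` (here for `K_{n+1}`, `n ≥ 0`; the clauses are `constMap_injective`, `psiRat_constMap`, `forall_boundaryAt_eq_zero_iff`, `exists_forall_boundaryAt_eq`). [cite: Milnor1970, §2 Theorem 2.3 (p0008 L12–L16)] -/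
theorem bijective_psiRat_prod_boundaryFamily :
    Function.Bijective fun z : MilnorK (RatFunc F) (n + 1) => (psiRat F (n + 1) z, boundaryFamily z) := by
  constructor
  · intro z₁ z₂ h
    simp only [Prod.mk.injEq] at h
    obtain ⟨h1, h2⟩ := h
    have h0 : ∀ v, boundaryAt F n v (z₁ - z₂) = 0 := fun v => by
      have := congrArg (fun e : FinSuppFamily F n => e.1 v) h2
      simp only [boundaryFamily_apply] at this
      rw [map_sub, this, sub_self]
    obtain ⟨b, hb⟩ := (forall_boundaryAt_eq_zero_iff _).1 h0
    have hb0 : b = 0 := by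
      have := congrArg (psiRat F (n + 1)) hb
      rwa [psiRat_constMap, map_sub, h1, sub_self] at this
    rw [hb0, map_zero] at hb
    exact (sub_eq_zero.1 hb.symm)
  · rintro ⟨β, e⟩
    obtain ⟨u, hu⟩ := exists_forall_boundaryAt_eq e.1 e.2
    refine ⟨u + constMap F (n + 1) (β - psiRat F (n + 1) u), ?_⟩
    simp only [Prod.mk.injEq]
    refine ⟨by rw [map_add, psiRat_constMap, add_sub_cancel], Subtype.ext (funext fun v => ?_)⟩
    rw [boundaryFamily_apply, map_add, boundaryAt_constMap, add_zero, hu]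

end Split

end MilnorK

end Literature.RingTheory.KTheory

end
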